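import Mathlib.Analysis.Complex.ReImTopology
import Mathlib.Analysis.Complex.Convex
import Mathlib.Analysis.Calculus.Deriv.Star
import Literature.Probability.RandomPlanarGeometry.ConformalRectangleProofs
import Literature.Probability.RandomPlanarGeometry.ConformalMapRiemannNormalisedProofs
import Literature.Probability.RandomPlanarGeometry.PolygonalDomains
import HarnessLib

/-!
# The symmetric Riemann map of a rectangle and its boundary correspondence

Topic `Literature/Probability/RandomPlanarGeometry` (support for the conformal modulus of a
rectangle, `RectangleModulus.lean` / `RectangleModulusProofs.lean`). For the open rectangle
`R = (-a, a) × (-b, b)` (`Literature.Probability.RandomPlanarGeometry.symRect a b`, `0 < a, b`):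

* `symRect` is open, bounded, convex, simply connected; its closure / frontier
  (`closure_symRect`, `frontier_symRect`); `Literature.Probability.RandomPlanarGeometry.rectDomain`
  — `R` as a `JordanDomain` whose boundary loop is the closed polygon through the corners
  (`polygonLoop (rectVerts a b)`, simple by `isSimpleClosedPolygon_rectVerts`, tracing exactly
  `frontier R` by `range_polygonLoop_rectVerts`).
* `Literature.Probability.RandomPlanarGeometry.rectMap` — THE normalised Riemann map
  `g : R → 𝔻`, `g 0 = 0`, `g'(0) > 0` (tree: `existsUnique_conformalEquiv_ball_holds`), with the
  symmetries `g (conj z) = conj (g z)`, `g (-z) = -g z` (`rectMap_conj`, `rectMap_neg`: the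
  reflected maps are again normalised, uniqueness; Conway (1978) VII.4.2), hence
  `Im g > 0` on the upper half and `Re g > 0` on the right half of `R` (`rectMap_im_pos`,
  `rectMap_re_pos`: connectedness and the first-order behaviour at `0`).
* `Literature.Probability.RandomPlanarGeometry.rectPsi` / `rectPhi` — the Carathéodory extension
  `Ψ` of `g⁻¹` to the closed disc (tree: `JordanDomain.exists_continuousOn_extension_holds`,
  Pommerenke (1992) Thm. 2.6) and its inverse `Φ : closure R → closed disc`, a continuous
  bijection extending `g`, unit circle ↔ frontier, with the same symmetries
  (`rectPhi_conj`, `rectPhi_neg`), unique (`rectPsi_unique`).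
* `Literature.Probability.RandomPlanarGeometry.rectTheta` — the **corner angle** `θ ∈ (0, π/2)`
  (`rectTheta_mem`) with `Φ(a + bi) = e^{iθ}` (`rectPhi_corner`); the other corners go to
  `e^{-iθ}`, `-e^{iθ}`, `e^{i(π-θ)}`, the midpoints `±a` of the vertical sides to `±1`
  (`rectPhi_ofReal`). Thus `2θ/2π` is the harmonic measure at the centre of the right side and
  the four corner images form the centrally symmetric quadruple `(w, vw, -w, -vw)`, `v = e^{2iθ}`,
  of `ConformalRectangle.exists_isUniformizing_of_symm` (`DiscRectangles.lean`), whose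
  cross-ratio is `(1 - cos 2θ)/2 = sin² θ`.
* Boundary correspondence of the sides: `arg Φ` is continuous and injective along a side
  (`continuousOn_injOn_arg_rectPhi`), strictly decreasing from `π - θ` to `θ` along the top side
  (`topArg`, `strictAntiOn_topArg`) and strictly increasing from `-θ` to `θ` along the right side
  (`rightArg`, `strictMonoOn_rightArg`); the open top side corresponds exactly to the open arc
  `(θ, π - θ)` and the open right side to `(-θ, θ)` (`topArg_mem`, `exists_top_of_mem_arc`,
  `rightArg_mem`, `exists_right_of_mem_arc`).
* Transport under similarities (`rectPhi_transport`: `Φ'(p) = η Φ(c p)` when `z ↦ c z` maps `R'`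
  onto `R` and `η c > 0`), whence the scale invariance `θ(λa, λb) = θ(a, b)` (`rectTheta_smul`)
  and the quarter-turn symmetry `θ(b, a) = π/2 - θ(a, b)` (`rectTheta_swap`).
* Two general constructions: `ConformalEquiv.precompAffine` (`z ↦ φ (c z + d)` on any source
  `U'` with `z ∈ U' ↔ c z + d ∈ U`) and `ConformalEquiv.conjConj` (`conj ∘ φ ∘ conj`).

Everything here is proved (no named facts). The file exists to discharge
`Literature.Probability.RandomPlanarGeometry.rectangle_crossRatio_eq_of_aspectRatio`
(Bollobás–Riordan (2006), Ch. 7 §7.1, p. 184) in `RectangleModulusProofs.lean` by the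
harmonic-measure route (Löwner's lemma, `Literature.Analysis.Complex.loewner_lemma`) instead of
the Schwarz–Christoffel parametrisation, which Mathlib lacks.

## Mathlib

USED: `Complex.reProdIm` (`×ℂ`) with `closure_reProdIm` / `frontier_reProdIm`,
`Convex.contractibleSpace` (simple connectivity), `differentiableAt_conj_conj_iff` /
`deriv_conj_conj` (`Mathlib.Analysis.Calculus.Deriv.Star`), `HasDerivAt.tendsto_slope_zero`,
`IsPreconnected.subset_or_subset`, `Set.EqOn.of_subset_closure`,
`ContinuousWithinAt.mem_closure`, `ContinuousOn.strictMonoOn_of_injOn_Icc` /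
`strictAntiOn_of_injOn_Icc`, `intermediate_value_Icc`, `Complex.arg` (`arg_of_re_nonneg`,
`continuousAt_arg`, `ext_norm_arg`). Tree: `polygonLoop` / `IsSimpleClosedPolygon`
(`PolygonalDomains`), `existsUnique_conformalEquiv_ball_holds`
(`ConformalMapRiemannNormalisedProofs`), `JordanDomain.exists_continuousOn_extension_holds`,
`continuousOn_invFunOn_of_isCompact` (`ConformalRectangleProofs`), `rotBall`
(`CaratheodoryHalfPlane`). Mathlib has no Riemann maps of polygons and no boundary
correspondence (searched `Riemann map`, `Caratheodory`, `rectangle conformal`).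

## References

* L. V. Ahlfors, *Complex Analysis*, 3rd ed. (1979), Ch. 6 §1.1 Thm. 1 (Riemann mapping theorem
  with uniqueness), Ch. 4 §6.5 (reflection principle).
* J. B. Conway, *Functions of One Complex Variable I*, 2nd ed. (1978), Ch. VII Thm. 4.2.
* Ch. Pommerenke, *Boundary Behaviour of Conformal Maps* (1992), Thm. 2.6 (Carathéodory),
  §4.4 (harmonic measure).
* B. Bollobás, O. Riordan, *Percolation* (2006), Ch. 7 §7.1, pp. 183–185 and Fig. 3
  ("if `f` is a conformal map, then so is `z ↦ conj f(conj z)`").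
-/

noncomputable section

open Set Filter Topology Complex Metric Function
open scoped Real ComplexConjugate

namespace Literature.Probability.RandomPlanarGeometry

/-! ### The open rectangle `(-a, a) × (-b, b)` -/

/-- The open axis-parallel rectangle `(-a, a) × (-b, b) ⊆ ℂ` centred at `0` (half-width `a`,
half-height `b`). [folklore] -/
def symRect (a b : ℝ) : Set ℂ := Ioo (-a) a ×ℂ Ioo (-b) b

variable {a b : ℝ}

/-- Membership in the rectangle. [folklore] -/
theorem mem_symRect {z : ℂ} : z ∈ symRect a b ↔ (-a < z.re ∧ z.re < a) ∧ (-b < z.im ∧ z.im < b) :=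
  mem_reProdIm

/-- The rectangle is open. [folklore] -/
theorem isOpen_symRect (a b : ℝ) : IsOpen (symRect a b) := isOpen_Ioo.reProdIm isOpen_Ioo

/-- The rectangle is bounded. [folklore] -/
theorem isBounded_symRect (a b : ℝ) : Bornology.IsBounded (symRect a b) :=
  (Metric.isBounded_Ioo _ _).reProdIm (Metric.isBounded_Ioo _ _)

/-- The rectangle is convex. [folklore] -/
theorem convex_symRect (a b : ℝ) : Convex ℝ (symRect a b) := by
  have h : symRect a b = ({z : ℂ | -a < z.re} ∩ {z : ℂ | z.re < a}) ∩ ({z : ℂ | -b < z.im} ∩ {z : ℂ | z.im < b}) := by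
    ext z; simp only [mem_symRect, mem_inter_iff, mem_setOf_eq]
  rw [h]
  exact ((convex_halfSpace_re_gt _).inter (convex_halfSpace_re_lt _)).inter
    ((convex_halfSpace_im_gt _).inter (convex_halfSpace_im_lt _))

/-- `0` lies in the rectangle. [folklore] -/
theorem zero_mem_symRect (ha : 0 < a) (hb : 0 < b) : (0 : ℂ) ∈ symRect a b := by
  simp only [mem_symRect, zero_re, zero_im]; exact ⟨⟨by linarith, ha⟩, by linarith, hb⟩

/-- The rectangle is connected. [folklore] -/
theorem isConnected_symRect (ha : 0 < a) (hb : 0 < b) : IsConnected (symRect a b) :=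
  (convex_symRect a b).isConnected ⟨0, zero_mem_symRect ha hb⟩

/-- The rectangle is simply connected (it is convex). [folklore] -/
theorem isSimplyConnected_symRect (ha : 0 < a) (hb : 0 < b) : IsSimplyConnected (symRect a b) := by
  have : ContractibleSpace (symRect a b) := (convex_symRect a b).contractibleSpace ⟨0, zero_mem_symRect ha hb⟩
  change SimplyConnectedSpace (symRect a b)
  infer_instance

/-- The rectangle is not the whole plane. [folklore] -/
theorem symRect_ne_univ (a b : ℝ) : symRect a b ≠ univ := fun h ↦
  NormedSpace.unbounded_univ ℝ ℂ (h ▸ isBounded_symRect a b)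

/-- The rectangle is symmetric under complex conjugation. [folklore] -/
theorem conj_mem_symRect {z : ℂ} : conj z ∈ symRect a b ↔ z ∈ symRect a b := by
  simp only [mem_symRect, conj_re, conj_im]; constructor <;> rintro ⟨h1, h2, h3⟩ <;>
    exact ⟨h1, by linarith, by linarith⟩

/-- The rectangle is symmetric under `z ↦ -z`. [folklore] -/
theorem neg_mem_symRect {z : ℂ} : -z ∈ symRect a b ↔ z ∈ symRect a b := by
  simp only [mem_symRect, neg_re, neg_im]; constructor <;> rintro ⟨⟨h1, h2⟩, h3, h4⟩ <;>
    exact ⟨⟨by linarith, by linarith⟩, by linarith, by linarith⟩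

/-- The closure of the rectangle is the closed rectangle. [folklore] -/
theorem closure_symRect (ha : 0 < a) (hb : 0 < b) : closure (symRect a b) = Icc (-a) a ×ℂ Icc (-b) b := by
  rw [symRect, closure_reProdIm, closure_Ioo (by linarith), closure_Ioo (by linarith)]

/-- Membership in the closed rectangle. [folklore] -/
theorem mem_closure_symRect (ha : 0 < a) (hb : 0 < b) {z : ℂ} :
    z ∈ closure (symRect a b) ↔ (-a ≤ z.re ∧ z.re ≤ a) ∧ (-b ≤ z.im ∧ z.im ≤ b) := by
  rw [closure_symRect ha hb]; exact mem_reProdIm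

/-- The frontier of the rectangle: the four closed sides. [folklore] -/
theorem frontier_symRect (ha : 0 < a) (hb : 0 < b) :
    frontier (symRect a b) = Icc (-a) a ×ℂ {-b, b} ∪ {-a, a} ×ℂ Icc (-b) b := by
  rw [symRect, frontier_reProdIm, closure_Ioo (by linarith), closure_Ioo (by linarith),
    frontier_Ioo (by linarith), frontier_Ioo (by linarith)]

/-- Membership in the frontier of the rectangle. [folklore] -/
theorem mem_frontier_symRect (ha : 0 < a) (hb : 0 < b) {z : ℂ} :
    z ∈ frontier (symRect a b) ↔ ((-a ≤ z.re ∧ z.re ≤ a) ∧ (z.im = -b ∨ z.im = b)) ∨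
      ((z.re = -a ∨ z.re = a) ∧ (-b ≤ z.im ∧ z.im ≤ b)) := by
  rw [frontier_symRect ha hb, mem_union, mem_reProdIm, mem_reProdIm]
  simp only [mem_Icc, mem_insert_iff, mem_singleton_iff]

/-! ### The rectangle as a Jordan domain -/

/-- The corners of the rectangle, counterclockwise from the bottom-left one. [folklore] -/
def rectVerts (a b : ℝ) : List ℂ := [⟨-a, -b⟩, ⟨a, -b⟩, ⟨a, b⟩, ⟨-a, b⟩]

/-- There are four corners. [folklore] -/
@[simp] theorem length_rectVerts (a b : ℝ) : (rectVerts a b).length = 4 := rfl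

/-- **The boundary of a non-degenerate rectangle is a simple closed polygon.** [folklore] -/
theorem isSimpleClosedPolygon_rectVerts (ha : 0 < a) (hb : 0 < b) :
    IsSimpleClosedPolygon (rectVerts a b) := by
  refine IsSimpleClosedPolygon.of_lt (by simp) ?_ ?_
  · intro k hk
    have : k < 4 := by simpa using hk
    interval_cases k <;> simp [rectVerts, Complex.ext_iff] <;> intro h <;> linarith
  · intro i j hi hj hij
    have hj4 : j < 4 := by simpa using hj
    interval_cases j <;> interval_cases i <;>
    · simp only [rectVerts, List.length_cons, List.length_nil, Nat.reduceAdd, Nat.reduceMod,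
        List.getElem_cons_zero, List.getElem_cons_succ, Set.disjoint_left]
      rintro _ ⟨θ, ⟨hθ0, hθ1⟩, rfl⟩ ⟨θ', ⟨hθ0', hθ1'⟩, h⟩
      have hre := congrArg Complex.re h
      have him := congrArg Complex.im h
      simp [AffineMap.lineMap_apply_module'] at hre him
      nlinarith

/-- A point `lineMap v_k v_{k+1} θ`, `θ ∈ [0, 1]`, of an edge of the rectangle lies on its
frontier. [folklore] -/
theorem lineMap_rectVerts_mem_frontier (ha : 0 < a) (hb : 0 < b) {k : ℕ} (hk : k < 4) {θ : ℝ}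
    (hθ : θ ∈ Icc (0 : ℝ) 1) :
    AffineMap.lineMap ((rectVerts a b)[k]'(by simpa using hk))
      ((rectVerts a b)[(k + 1) % 4]'(by simp; omega)) θ ∈ frontier (symRect a b) := by
  rw [mem_frontier_symRect ha hb]
  obtain ⟨hθ0, hθ1⟩ := hθ
  interval_cases k
  · refine Or.inl ⟨⟨?_, ?_⟩, Or.inl ?_⟩ <;>
      simp [rectVerts, AffineMap.lineMap_apply_module'] <;> nlinarith
  · refine Or.inr ⟨Or.inr ?_, ?_, ?_⟩ <;>
      simp [rectVerts, AffineMap.lineMap_apply_module'] <;> nlinarith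
  · refine Or.inl ⟨⟨?_, ?_⟩, Or.inr ?_⟩ <;>
      simp [rectVerts, AffineMap.lineMap_apply_module'] <;> nlinarith
  · refine Or.inr ⟨Or.inl ?_, ?_, ?_⟩ <;>
      simp [rectVerts, AffineMap.lineMap_apply_module'] <;> nlinarith

/-- **The closed polygon through the corners traces exactly the frontier of the rectangle.**
[folklore] -/
theorem range_polygonLoop_rectVerts (ha : 0 < a) (hb : 0 < b) :
    range (polygonLoop (rectVerts a b)) = frontier (symRect a b) := by
  have hl : rectVerts a b ≠ [] := by simp [rectVerts]
  rw [range_polygonLoop hl]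
  apply Subset.antisymm
  · intro z hz
    simp only [mem_iUnion, segment_eq_image_lineMap, mem_image] at hz
    obtain ⟨⟨k, hk⟩, θ, hθ, rfl⟩ := hz
    have hk4 : k < 4 := by simpa using hk
    exact lineMap_rectVerts_mem_frontier ha hb hk4 hθ
  · intro z hz
    rw [mem_frontier_symRect ha hb] at hz
    simp only [mem_iUnion, segment_eq_image_lineMap, mem_image, mem_Icc, length_rectVerts]
    rcases hz with ⟨⟨h1, h2⟩, h3 | h3⟩ | ⟨h3 | h3, h1, h2⟩
    · -- bottom side: edge 0, from `(-a,-b)` to `(a,-b)`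
      set θ : ℝ := (z.re + a) / (2 * a) with hθ
      have hθ' : θ * (2 * a) = z.re + a := by rw [hθ]; field_simp
      refine ⟨⟨0, by norm_num⟩, θ, ⟨by apply div_nonneg <;> linarith, ?_⟩, ?_⟩
      · rw [hθ, div_le_one (by positivity)]; linarith
      · apply Complex.ext
        · simp [rectVerts, AffineMap.lineMap_apply_module']; linarith
        · simp [rectVerts, AffineMap.lineMap_apply_module', h3]
    · -- top side: edge 2, from `(a,b)` to `(-a,b)`
      set θ : ℝ := (a - z.re) / (2 * a) with hθ
      have hθ' : θ * (2 * a) = a - z.re := by rw [hθ]; field_simp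
      refine ⟨⟨2, by norm_num⟩, θ, ⟨by apply div_nonneg <;> linarith, ?_⟩, ?_⟩
      · rw [hθ, div_le_one (by positivity)]; linarith
      · apply Complex.ext
        · simp [rectVerts, AffineMap.lineMap_apply_module']; linarith
        · simp [rectVerts, AffineMap.lineMap_apply_module', h3]
    · -- left side: edge 3, from `(-a,b)` to `(-a,-b)`
      set θ : ℝ := (b - z.im) / (2 * b) with hθ
      have hθ' : θ * (2 * b) = b - z.im := by rw [hθ]; field_simp
      refine ⟨⟨3, by norm_num⟩, θ, ⟨by apply div_nonneg <;> linarith, ?_⟩, ?_⟩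
      · rw [hθ, div_le_one (by positivity)]; linarith
      · apply Complex.ext
        · simp [rectVerts, AffineMap.lineMap_apply_module', h3]
        · simp [rectVerts, AffineMap.lineMap_apply_module']; linarith
    · -- right side: edge 1, from `(a,-b)` to `(a,b)`
      set θ : ℝ := (z.im + b) / (2 * b) with hθ
      have hθ' : θ * (2 * b) = z.im + b := by rw [hθ]; field_simp
      refine ⟨⟨1, by norm_num⟩, θ, ⟨by apply div_nonneg <;> linarith, ?_⟩, ?_⟩
      · rw [hθ, div_le_one (by positivity)]; linarith
      · apply Complex.ext
        · simp [rectVerts, AffineMap.lineMap_apply_module', h3]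
        · simp [rectVerts, AffineMap.lineMap_apply_module']; linarith

/-- **The rectangle `(-a, a) × (-b, b)` as a Jordan domain**, with boundary loop the closed polygon
through its corners (counterclockwise from the bottom-left corner). [folklore] -/
def rectDomain (a b : ℝ) (ha : 0 < a) (hb : 0 < b) : JordanDomain where
  carrier := symRect a b
  boundary := polygonLoop (rectVerts a b)
  isOpen := isOpen_symRect a b
  isBounded := isBounded_symRect a b
  isConnected := isConnected_symRect ha hb
  continuous_boundary := continuous_polygonLoop _
  periodic_boundary := periodic_polygonLoop _
  injOn_boundary := injOn_polygonLoop (isSimpleClosedPolygon_rectVerts ha hb)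
  range_boundary := range_polygonLoop_rectVerts ha hb

/-- The carrier of the rectangle Jordan domain is the open rectangle (by definition). [folklore] -/
@[simp] theorem rectDomain_carrier (ha : 0 < a) (hb : 0 < b) : (rectDomain a b ha hb).carrier = symRect a b :=
  rfl


/-! ### Two constructions of conformal equivalences -/

namespace ConformalEquiv

variable {U V : Set ℂ}

/-- **Precomposition with an affine map**: from `φ : U → V` and `z ↦ c z + d` (`c ≠ 0`) mapping `U'`
onto `U`, the conformal equivalence `z ↦ φ (c z + d) : U' → V`. The source `U'` is any set with
`z ∈ U' ↔ c z + d ∈ U` (so set equalities are transported at the same time). [folklore] -/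
def precompAffine (φ : ConformalEquiv U V) (c d : ℂ) (hc : c ≠ 0) (U' : Set ℂ)
    (hU' : ∀ z, z ∈ U' ↔ c * z + d ∈ U) : ConformalEquiv U' V where
  toFun z := φ (c * z + d)
  invFun w := (φ.symm w - d) / c
  source := U'
  target := V
  map_source' z hz := φ.mapsTo ((hU' z).1 hz)
  map_target' w hw := (hU' _).2 (by
    rw [mul_div_cancel₀ _ hc, sub_add_cancel]; exact φ.symm_mapsTo hw)
  left_inv' z hz := by
    rw [φ.symm_apply_apply ((hU' z).1 hz), add_sub_cancel_right, mul_div_cancel_left₀ _ hc]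
  right_inv' w hw := by
    rw [mul_div_cancel₀ _ hc, sub_add_cancel, φ.apply_symm_apply hw]
  source_eq := rfl
  target_eq := rfl
  differentiableOn :=
    φ.differentiableOn.comp ((differentiableOn_id.const_mul c).add_const d) fun z hz ↦ (hU' z).1 hz
  differentiableOn_symm := (φ.symm.differentiableOn_coe.sub_const d).div_const c

/-- Unfolding `precompAffine`. [folklore] -/
@[simp] theorem precompAffine_apply (φ : ConformalEquiv U V) (c d : ℂ) (hc : c ≠ 0) (U' : Set ℂ)
    (hU' : ∀ z, z ∈ U' ↔ c * z + d ∈ U) (z : ℂ) : φ.precompAffine c d hc U' hU' z = φ (c * z + d) :=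
  rfl

/-- Unfolding the inverse of `precompAffine`. [folklore] -/
@[simp] theorem precompAffine_symm_apply (φ : ConformalEquiv U V) (c d : ℂ) (hc : c ≠ 0)
    (U' : Set ℂ) (hU' : ∀ z, z ∈ U' ↔ c * z + d ∈ U) (w : ℂ) :
    (φ.precompAffine c d hc U' hU').symm w = (φ.symm w - d) / c :=
  rfl

/-- **The reflected conformal equivalence `conj ∘ φ ∘ conj : U → V`** of conjugation-symmetric
open sets (Ahlfors (1979), Ch. 4 §6.5; B.–R. (2006), Ch. 7 Fig. 3: "if `f` is a conformal map,
then so is `z ↦ conj (f (conj z))`"). [folklore] -/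
def conjConj (φ : ConformalEquiv U V) (hUo : IsOpen U) (hVo : IsOpen V)
    (hU : ∀ z, conj z ∈ U ↔ z ∈ U) (hV : ∀ w, conj w ∈ V ↔ w ∈ V) : ConformalEquiv U V where
  toFun z := conj (φ (conj z))
  invFun w := conj (φ.symm (conj w))
  source := U
  target := V
  map_source' z hz := (hV _).2 (φ.mapsTo ((hU z).2 hz))
  map_target' w hw := (hU _).2 (φ.symm_mapsTo ((hV w).2 hw))
  left_inv' z hz := by
    rw [Complex.conj_conj, φ.symm_apply_apply ((hU z).2 hz), Complex.conj_conj]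
  right_inv' w hw := by
    rw [Complex.conj_conj, φ.apply_symm_apply ((hV w).2 hw), Complex.conj_conj]
  source_eq := rfl
  target_eq := rfl
  differentiableOn := by
    intro z hz
    have h : DifferentiableAt ℂ (conj ∘ φ ∘ conj) z :=
      differentiableAt_conj_conj_iff.2
        ((φ.differentiableOn _ ((hU z).2 hz)).differentiableAt (hUo.mem_nhds ((hU z).2 hz)))
    exact h.differentiableWithinAt
  differentiableOn_symm := by
    intro w hw
    have h : DifferentiableAt ℂ (conj ∘ φ.symm ∘ conj) w :=
      differentiableAt_conj_conj_iff.2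
        ((φ.symm.differentiableOn _ ((hV w).2 hw)).differentiableAt (hVo.mem_nhds ((hV w).2 hw)))
    exact h.differentiableWithinAt

/-- Unfolding `conjConj`. [folklore] -/
@[simp] theorem conjConj_apply (φ : ConformalEquiv U V) (hUo : IsOpen U) (hVo : IsOpen V)
    (hU : ∀ z, conj z ∈ U ↔ z ∈ U) (hV : ∀ w, conj w ∈ V ↔ w ∈ V) (z : ℂ) :
    φ.conjConj hUo hVo hU hV z = conj (φ (conj z)) :=
  rfl

end ConformalEquiv

/-- The unit disc is conjugation-symmetric. [folklore] -/
theorem conj_mem_ball_iff (w : ℂ) : conj w ∈ ball (0 : ℂ) 1 ↔ w ∈ ball (0 : ℂ) 1 := by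
  rw [mem_ball_zero_iff, mem_ball_zero_iff, norm_conj]

/-! ### The symmetric Riemann map of the rectangle -/

section RiemannMap

/-- The normalised Riemann map of the rectangle exists and is unique (tree:
`existsUnique_conformalEquiv_ball_holds`). [cite: AhlforsCA1979, Ch. 6 §1.1 Thm. 1] -/
theorem exists_rectMap (a b : ℝ) (ha : 0 < a) (hb : 0 < b) :
    ∃ φ : ConformalEquiv (symRect a b) (ball 0 1), (φ 0 = 0 ∧ 0 < (deriv φ 0).re ∧
      (deriv φ 0).im = 0) ∧ ∀ ψ : ConformalEquiv (symRect a b) (ball 0 1),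
      ψ 0 = 0 → 0 < (deriv ψ 0).re → (deriv ψ 0).im = 0 → EqOn ψ φ (symRect a b) :=
  existsUnique_conformalEquiv_ball_holds (isOpen_symRect a b) (isSimplyConnected_symRect ha hb)
    (symRect_ne_univ a b) (zero_mem_symRect ha hb)

/-- **The symmetric Riemann map of the rectangle**: the conformal equivalence
`g : (-a,a)×(-b,b) → 𝔻` with `g 0 = 0`, `g'(0) > 0` (Ahlfors (1979), Ch. 6 §1.1, Thm. 1).
[cite: AhlforsCA1979, Ch. 6 §1.1 Thm. 1] -/
def rectMap (a b : ℝ) (ha : 0 < a) (hb : 0 < b) : ConformalEquiv (symRect a b) (ball 0 1) :=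
  (exists_rectMap a b ha hb).choose

/-- `g 0 = 0`. [folklore] -/
theorem rectMap_zero (ha : 0 < a) (hb : 0 < b) : rectMap a b ha hb 0 = 0 :=
  (exists_rectMap a b ha hb).choose_spec.1.1

/-- `g'(0)` is a positive real number. [folklore] -/
theorem deriv_rectMap (ha : 0 < a) (hb : 0 < b) :
    0 < (deriv (rectMap a b ha hb) 0).re ∧ (deriv (rectMap a b ha hb) 0).im = 0 :=
  (exists_rectMap a b ha hb).choose_spec.1.2

/-- **Uniqueness**: any conformal `ψ : (-a,a)×(-b,b) → 𝔻` with `ψ 0 = 0`, `ψ'(0) > 0` is `g`.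
[cite: AhlforsCA1979, Ch. 6 §1.1 Thm. 1] -/
theorem rectMap_unique (ha : 0 < a) (hb : 0 < b) (ψ : ConformalEquiv (symRect a b) (ball 0 1)) (h0 : ψ 0 = 0)
    (hre : 0 < (deriv ψ 0).re) (him : (deriv ψ 0).im = 0) : EqOn ψ (rectMap a b ha hb) (symRect a b) :=
  (exists_rectMap a b ha hb).choose_spec.2 ψ h0 hre him

/-- `g` has derivative `deriv g 0` at `0`. [folklore] -/
theorem hasDerivAt_rectMap (ha : 0 < a) (hb : 0 < b) :
    HasDerivAt (rectMap a b ha hb) (deriv (rectMap a b ha hb) 0) 0 :=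
  (((rectMap a b ha hb).differentiableOn 0 (zero_mem_symRect ha hb)).differentiableAt
    ((isOpen_symRect a b).mem_nhds (zero_mem_symRect ha hb))).hasDerivAt

/-- **Conjugation symmetry of the Riemann map**: `g (conj z) = conj (g z)` (the rectangle is
symmetric and `conj ∘ g ∘ conj` is again normalised; uniqueness). Conway (1978), VII.4.2;
cf. `Complex.exists_bijOn_ball_symmetric`. [cite: Conway1978, Ch. VII Thm. 4.2] -/
theorem rectMap_conj (ha : 0 < a) (hb : 0 < b) {z : ℂ} (hz : z ∈ symRect a b) :
    rectMap a b ha hb (conj z) = conj (rectMap a b ha hb z) := by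
  set ψ := (rectMap a b ha hb).conjConj (isOpen_symRect a b) isOpen_ball (fun _ ↦ conj_mem_symRect)
    conj_mem_ball_iff with hψ
  have hψ0 : ψ 0 = 0 := by
    rw [hψ, ConformalEquiv.conjConj_apply, map_zero, rectMap_zero ha hb, map_zero]
  have hd : deriv ψ 0 = conj (deriv (rectMap a b ha hb) 0) := by
    have h1 : (ψ : ℂ → ℂ) = conj ∘ (rectMap a b ha hb) ∘ conj := by
      funext w; rw [hψ, ConformalEquiv.conjConj_apply]; rfl
    rw [h1, deriv_conj_conj]
    simp
  have hre : 0 < (deriv ψ 0).re := by rw [hd, conj_re]; exact (deriv_rectMap ha hb).1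
  have him : (deriv ψ 0).im = 0 := by rw [hd, conj_im, (deriv_rectMap ha hb).2, neg_zero]
  have h := rectMap_unique ha hb ψ hψ0 hre him (conj_mem_symRect.2 hz)
  rw [hψ, ConformalEquiv.conjConj_apply, Complex.conj_conj] at h
  exact h.symm

/-- **Central symmetry of the Riemann map**: `g (-z) = -g z` (`-g(-·)` is again normalised;
uniqueness). [cite: Conway1978, Ch. VII Thm. 4.2] -/
theorem rectMap_neg (ha : 0 < a) (hb : 0 < b) {z : ℂ} (hz : z ∈ symRect a b) :
    rectMap a b ha hb (-z) = -rectMap a b ha hb z := by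
  have hn1 : ‖(-1 : ℂ)‖ = 1 := by simp
  set ψ := ((rectMap a b ha hb).precompAffine (-1) 0 (by norm_num) (symRect a b)
    (fun w ↦ by rw [neg_one_mul, add_zero]; exact neg_mem_symRect.symm)).trans (rotBall (-1) hn1) with hψ
  have hψapp : ∀ w, ψ w = -rectMap a b ha hb (-w) := fun w ↦ by
    rw [hψ, ConformalEquiv.trans_apply, rotBall_apply, ConformalEquiv.precompAffine_apply,
      neg_one_mul, add_zero, neg_one_mul]
  have hψ0 : ψ 0 = 0 := by rw [hψapp, neg_zero, rectMap_zero ha hb, neg_zero]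
  have hd : deriv ψ 0 = deriv (rectMap a b ha hb) 0 := by
    have h1 : (ψ : ℂ → ℂ) = fun w ↦ -rectMap a b ha hb (-w) := funext hψapp
    have h2 : HasDerivAt (fun w ↦ -rectMap a b ha hb (-w)) (deriv (rectMap a b ha hb) 0) 0 := by
      have h3 : HasDerivAt (rectMap a b ha hb) (deriv (rectMap a b ha hb) 0) (-0) := by
        rw [neg_zero]; exact hasDerivAt_rectMap ha hb
      have h4 := (h3.comp 0 (hasDerivAt_neg 0)).neg
      rw [mul_neg_one, neg_neg] at h4
      exact h4
    rw [h1, h2.deriv]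
  have h := rectMap_unique ha hb ψ hψ0 (hd ▸ (deriv_rectMap ha hb).1)
    (hd ▸ (deriv_rectMap ha hb).2) (neg_mem_symRect.2 hz)
  rw [hψapp, neg_neg] at h
  exact h.symm

/-- The composite symmetry `g (-conj z) = -conj (g z)` (reflection in the imaginary axis). [folklore] -/
theorem rectMap_neg_conj (ha : 0 < a) (hb : 0 < b) {z : ℂ} (hz : z ∈ symRect a b) :
    rectMap a b ha hb (-conj z) = -conj (rectMap a b ha hb z) := by
  rw [rectMap_neg ha hb (conj_mem_symRect.2 hz), rectMap_conj ha hb hz]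

end RiemannMap


/-! ### The Carathéodory extension and the boundary correspondence `Φ : closure → closed disc` -/

section Boundary

/-- Carathéodory's theorem for the rectangle (tree: `JordanDomain.exists_continuousOn_extension_holds`):
`g⁻¹ : 𝔻 → (-a,a)×(-b,b)` extends to a homeomorphism of the closed disc onto the closed rectangle,
circle onto the frontier. [cite: PommerenkeBBCM1992, Thm. 2.6] -/
theorem exists_rectPsi (ha : 0 < a) (hb : 0 < b) :
    ∃ Ψ : ℂ → ℂ, ContinuousOn Ψ (closedBall 0 1) ∧ EqOn Ψ (rectMap a b ha hb).symm (ball 0 1) ∧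
      BijOn Ψ (closedBall 0 1) (closure (symRect a b)) ∧ BijOn Ψ (sphere 0 1) (frontier (symRect a b)) :=
  JordanDomain.exists_continuousOn_extension_holds (rectDomain a b ha hb) (rectMap a b ha hb).symm

/-- **The Carathéodory extension `Ψ` of `g⁻¹`** to the closed unit disc. [cite: PommerenkeBBCM1992, Thm. 2.6] -/
def rectPsi (a b : ℝ) (ha : 0 < a) (hb : 0 < b) : ℂ → ℂ :=
  (exists_rectPsi ha hb).choose

/-- `Ψ` is continuous on the closed disc. [cite: PommerenkeBBCM1992, Thm. 2.6] -/
theorem continuousOn_rectPsi (ha : 0 < a) (hb : 0 < b) :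
    ContinuousOn (rectPsi a b ha hb) (closedBall 0 1) :=
  (exists_rectPsi ha hb).choose_spec.1

/-- `Ψ = g⁻¹` on the open disc. [folklore] -/
theorem rectPsi_eqOn (ha : 0 < a) (hb : 0 < b) :
    EqOn (rectPsi a b ha hb) (rectMap a b ha hb).symm (ball 0 1) :=
  (exists_rectPsi ha hb).choose_spec.2.1

/-- `Ψ` is a bijection of the closed disc onto the closed rectangle. [cite: PommerenkeBBCM1992, Thm. 2.6] -/
theorem bijOn_rectPsi (ha : 0 < a) (hb : 0 < b) :
    BijOn (rectPsi a b ha hb) (closedBall 0 1) (closure (symRect a b)) :=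
  (exists_rectPsi ha hb).choose_spec.2.2.1

/-- `Ψ` is a bijection of the unit circle onto the frontier of the rectangle. [cite: PommerenkeBBCM1992, Thm. 2.6] -/
theorem bijOn_rectPsi_sphere (ha : 0 < a) (hb : 0 < b) :
    BijOn (rectPsi a b ha hb) (sphere 0 1) (frontier (symRect a b)) :=
  (exists_rectPsi ha hb).choose_spec.2.2.2

/-- **Uniqueness of the continuous extension**: any continuous extension of `g⁻¹` to the closed
disc is `Ψ` (the open disc is dense). [folklore] -/
theorem rectPsi_unique (ha : 0 < a) (hb : 0 < b) {Ψ' : ℂ → ℂ} (hc : ContinuousOn Ψ' (closedBall 0 1))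
    (heq : EqOn Ψ' (rectMap a b ha hb).symm (ball 0 1)) :
    EqOn Ψ' (rectPsi a b ha hb) (closedBall 0 1) :=
  (heq.trans (rectPsi_eqOn ha hb).symm).of_subset_closure hc (continuousOn_rectPsi ha hb)
    ball_subset_closedBall (by rw [closure_ball (0 : ℂ) one_ne_zero])

/-- **The boundary correspondence `Φ = Ψ⁻¹ : closed rectangle → closed disc`** (the continuous
extension of `g` to the closed rectangle). [folklore] -/
def rectPhi (a b : ℝ) (ha : 0 < a) (hb : 0 < b) : ℂ → ℂ :=
  invFunOn (rectPsi a b ha hb) (closedBall 0 1)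

/-- `Φ` and `Ψ` are mutually inverse between the closed rectangle and the closed disc. [folklore] -/
theorem invOn_rectPhi (ha : 0 < a) (hb : 0 < b) :
    InvOn (rectPhi a b ha hb) (rectPsi a b ha hb) (closedBall 0 1) (closure (symRect a b)) :=
  (bijOn_rectPsi ha hb).invOn_invFunOn

/-- `Φ` maps the closed rectangle into the closed disc. [folklore] -/
theorem mapsTo_rectPhi (ha : 0 < a) (hb : 0 < b) :
    MapsTo (rectPhi a b ha hb) (closure (symRect a b)) (closedBall 0 1) :=
  (bijOn_rectPsi ha hb).surjOn.mapsTo_invFunOn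

/-- `Φ` is a bijection of the closed rectangle onto the closed disc. [folklore] -/
theorem bijOn_rectPhi (ha : 0 < a) (hb : 0 < b) :
    BijOn (rectPhi a b ha hb) (closure (symRect a b)) (closedBall 0 1) :=
  (invOn_rectPhi ha hb).symm.bijOn (mapsTo_rectPhi ha hb) (bijOn_rectPsi ha hb).mapsTo

/-- `Φ` is injective on the closed rectangle. [folklore] -/
theorem injOn_rectPhi (ha : 0 < a) (hb : 0 < b) : InjOn (rectPhi a b ha hb) (closure (symRect a b)) :=
  (bijOn_rectPhi ha hb).injOn

/-- **`Φ` is continuous on the closed rectangle** (inverse of a continuous bijection of a compact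
set). [folklore] -/
theorem continuousOn_rectPhi (ha : 0 < a) (hb : 0 < b) :
    ContinuousOn (rectPhi a b ha hb) (closure (symRect a b)) :=
  continuousOn_invFunOn_of_isCompact (isCompact_closedBall 0 1) (continuousOn_rectPsi ha hb)
    (bijOn_rectPsi ha hb)

/-- `Ψ (Φ p) = p` on the closed rectangle. [folklore] -/
theorem rectPsi_rectPhi (ha : 0 < a) (hb : 0 < b) {p : ℂ} (hp : p ∈ closure (symRect a b)) :
    rectPsi a b ha hb (rectPhi a b ha hb p) = p :=
  (invOn_rectPhi ha hb).2 hp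

/-- `Φ (Ψ ζ) = ζ` on the closed disc. [folklore] -/
theorem rectPhi_rectPsi (ha : 0 < a) (hb : 0 < b) {ζ : ℂ} (hζ : ζ ∈ closedBall (0 : ℂ) 1) :
    rectPhi a b ha hb (rectPsi a b ha hb ζ) = ζ :=
  (invOn_rectPhi ha hb).1 hζ

/-- **`Φ = g` on the open rectangle.** [folklore] -/
theorem rectPhi_eq (ha : 0 < a) (hb : 0 < b) {z : ℂ} (hz : z ∈ symRect a b) :
    rectPhi a b ha hb z = rectMap a b ha hb z := by
  have h1 : rectMap a b ha hb z ∈ ball (0 : ℂ) 1 := (rectMap a b ha hb).mapsTo hz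
  have h2 : rectPsi a b ha hb (rectMap a b ha hb z) = z := by
    rw [rectPsi_eqOn ha hb h1, (rectMap a b ha hb).symm_apply_apply hz]
  conv_lhs => rw [← h2]
  exact rectPhi_rectPsi ha hb (ball_subset_closedBall h1)

/-- `Φ` maps the frontier of the rectangle into the unit circle. [folklore] -/
theorem rectPhi_mem_sphere (ha : 0 < a) (hb : 0 < b) {p : ℂ} (hp : p ∈ frontier (symRect a b)) :
    rectPhi a b ha hb p ∈ sphere (0 : ℂ) 1 := by
  obtain ⟨ζ, hζ, rfl⟩ := (bijOn_rectPsi_sphere ha hb).surjOn hp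
  rw [rectPhi_rectPsi ha hb (sphere_subset_closedBall hζ)]
  exact hζ

/-- `‖Φ p‖ = 1` on the frontier. [folklore] -/
theorem norm_rectPhi (ha : 0 < a) (hb : 0 < b) {p : ℂ} (hp : p ∈ frontier (symRect a b)) :
    ‖rectPhi a b ha hb p‖ = 1 :=
  mem_sphere_zero_iff_norm.1 (rectPhi_mem_sphere ha hb hp)

/-- `Ψ` maps the unit circle into the frontier. [folklore] -/
theorem rectPsi_mem_frontier (ha : 0 < a) (hb : 0 < b) {ζ : ℂ} (hζ : ζ ∈ sphere (0 : ℂ) 1) :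
    rectPsi a b ha hb ζ ∈ frontier (symRect a b) :=
  (bijOn_rectPsi_sphere ha hb).mapsTo hζ

/-- `Ψ` maps the open disc into the open rectangle. [folklore] -/
theorem rectPsi_mem_symRect (ha : 0 < a) (hb : 0 < b) {ζ : ℂ} (hζ : ζ ∈ ball (0 : ℂ) 1) :
    rectPsi a b ha hb ζ ∈ symRect a b := by
  rw [rectPsi_eqOn ha hb hζ]; exact (rectMap a b ha hb).symm_mapsTo hζ

/-- The frontier of the rectangle lies in its closure. [folklore] -/
theorem frontier_rect_subset_closure (a b : ℝ) : frontier (symRect a b) ⊆ closure (symRect a b) :=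
  frontier_subset_closure

/-- The closed rectangle is conjugation-symmetric. [folklore] -/
theorem conj_mem_closure_symRect (ha : 0 < a) (hb : 0 < b) {z : ℂ} :
    conj z ∈ closure (symRect a b) ↔ z ∈ closure (symRect a b) := by
  simp only [mem_closure_symRect ha hb, conj_re, conj_im]
  constructor <;> rintro ⟨h1, h2, h3⟩ <;> exact ⟨h1, by linarith, by linarith⟩

/-- The closed rectangle is symmetric under `z ↦ -z`. [folklore] -/
theorem neg_mem_closure_symRect (ha : 0 < a) (hb : 0 < b) {z : ℂ} :
    -z ∈ closure (symRect a b) ↔ z ∈ closure (symRect a b) := by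
  simp only [mem_closure_symRect ha hb, neg_re, neg_im]
  constructor <;> rintro ⟨⟨h1, h2⟩, h3, h4⟩ <;> exact ⟨⟨by linarith, by linarith⟩, by linarith, by linarith⟩

/-- **Conjugation symmetry of the boundary correspondence**: `Φ (conj p) = conj (Φ p)` on the closed
rectangle (from `g ∘ conj = conj ∘ g` by continuity). [folklore] -/
theorem rectPhi_conj (ha : 0 < a) (hb : 0 < b) {p : ℂ} (hp : p ∈ closure (symRect a b)) :
    rectPhi a b ha hb (conj p) = conj (rectPhi a b ha hb p) := by
  have key : EqOn (fun q ↦ rectPhi a b ha hb (conj q)) (fun q ↦ conj (rectPhi a b ha hb q))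
      (closure (symRect a b)) := by
    refine EqOn.of_subset_closure (s := symRect a b) ?_ ?_ ?_ subset_closure Subset.rfl
    · intro q hq
      simp only
      rw [rectPhi_eq ha hb hq, rectPhi_eq ha hb (conj_mem_symRect.2 hq), rectMap_conj ha hb hq]
    · exact (continuousOn_rectPhi ha hb).comp continuous_conj.continuousOn
        fun q hq ↦ (conj_mem_closure_symRect ha hb).2 hq
    · exact continuous_conj.comp_continuousOn (continuousOn_rectPhi ha hb)
  exact key hp

/-- **Central symmetry of the boundary correspondence**: `Φ (-p) = -Φ p` on the closed rectangle.
[folklore] -/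
theorem rectPhi_neg (ha : 0 < a) (hb : 0 < b) {p : ℂ} (hp : p ∈ closure (symRect a b)) :
    rectPhi a b ha hb (-p) = -rectPhi a b ha hb p := by
  have key : EqOn (fun q ↦ rectPhi a b ha hb (-q)) (fun q ↦ -rectPhi a b ha hb q)
      (closure (symRect a b)) := by
    refine EqOn.of_subset_closure (s := symRect a b) ?_ ?_ ?_ subset_closure Subset.rfl
    · intro q hq
      simp only
      rw [rectPhi_eq ha hb hq, rectPhi_eq ha hb (neg_mem_symRect.2 hq), rectMap_neg ha hb hq]
    · exact (continuousOn_rectPhi ha hb).comp continuous_neg.continuousOn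
        fun q hq ↦ (neg_mem_closure_symRect ha hb).2 hq
    · exact continuous_neg.comp_continuousOn (continuousOn_rectPhi ha hb)
  exact key hp

/-- The reflection in the imaginary axis: `Φ (-conj p) = -conj (Φ p)`. [folklore] -/
theorem rectPhi_neg_conj (ha : 0 < a) (hb : 0 < b) {p : ℂ} (hp : p ∈ closure (symRect a b)) :
    rectPhi a b ha hb (-conj p) = -conj (rectPhi a b ha hb p) := by
  rw [rectPhi_neg ha hb ((conj_mem_closure_symRect ha hb).2 hp), rectPhi_conj ha hb hp]

/-- `Ψ (conj ζ) = conj (Ψ ζ)` on the closed disc. [folklore] -/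
theorem rectPsi_conj (ha : 0 < a) (hb : 0 < b) {ζ : ℂ} (hζ : ζ ∈ closedBall (0 : ℂ) 1) :
    rectPsi a b ha hb (conj ζ) = conj (rectPsi a b ha hb ζ) := by
  have hζ' : conj ζ ∈ closedBall (0 : ℂ) 1 := by
    rw [mem_closedBall_zero_iff, norm_conj]; exact mem_closedBall_zero_iff.1 hζ
  have h1 : rectPsi a b ha hb ζ ∈ closure (symRect a b) := (bijOn_rectPsi ha hb).mapsTo hζ
  apply injOn_rectPhi ha hb ((bijOn_rectPsi ha hb).mapsTo hζ') ((conj_mem_closure_symRect ha hb).2 h1)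
  rw [rectPhi_rectPsi ha hb hζ', rectPhi_conj ha hb h1, rectPhi_rectPsi ha hb hζ]

/-- `Ψ (-ζ) = -Ψ ζ` on the closed disc. [folklore] -/
theorem rectPsi_neg (ha : 0 < a) (hb : 0 < b) {ζ : ℂ} (hζ : ζ ∈ closedBall (0 : ℂ) 1) :
    rectPsi a b ha hb (-ζ) = -rectPsi a b ha hb ζ := by
  have hζ' : -ζ ∈ closedBall (0 : ℂ) 1 := by
    rw [mem_closedBall_zero_iff, norm_neg]; exact mem_closedBall_zero_iff.1 hζ
  have h1 : rectPsi a b ha hb ζ ∈ closure (symRect a b) := (bijOn_rectPsi ha hb).mapsTo hζ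
  apply injOn_rectPhi ha hb ((bijOn_rectPsi ha hb).mapsTo hζ') ((neg_mem_closure_symRect ha hb).2 h1)
  rw [rectPhi_rectPsi ha hb hζ', rectPhi_neg ha hb h1, rectPhi_rectPsi ha hb hζ]

end Boundary

/-! ### The Riemann map preserves the four half-rectangles; the corner angle `θ` -/

section Corner

/-- **A first-order witness**: in the direction `v` (`v = 1` or `v = I`) there is a small `s > 0`
with `v s` in the rectangle and `Re (g(v s)/(v s)) > 0` (because `g(z)/z → g'(0) > 0`). [folklore] -/
theorem exists_re_div_pos (ha : 0 < a) (hb : 0 < b) {v : ℂ} (hv : v ≠ 0) :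
    ∃ s : ℝ, 0 < s ∧ v * s ∈ symRect a b ∧ 0 < ((v * s)⁻¹ * rectMap a b ha hb (v * s)).re := by
  set g := rectMap a b ha hb with hg
  have hd := (hasDerivAt_rectMap ha hb).tendsto_slope_zero
  rw [rectMap_zero ha hb] at hd
  simp only [zero_add, sub_zero, smul_eq_mul] at hd
  -- approach `0` along `s ↦ v s`, `s → 0⁺`
  have hpath : Tendsto (fun s : ℝ ↦ v * s) (𝓝[>] (0 : ℝ)) (𝓝[≠] (0 : ℂ)) := by
    refine tendsto_nhdsWithin_iff.2 ⟨?_, ?_⟩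
    · have : Continuous fun s : ℝ ↦ v * s := by fun_prop
      simpa using (this.tendsto 0).mono_left nhdsWithin_le_nhds
    · filter_upwards [self_mem_nhdsWithin] with s hs
      exact mul_ne_zero hv (ofReal_ne_zero.2 (ne_of_gt hs))
  have h1 := hd.comp hpath
  have h2 : ∀ᶠ s : ℝ in 𝓝[>] 0, 0 < ((v * s)⁻¹ * g (v * s)).re := by
    have := ((continuous_re.tendsto _).comp h1).eventually_const_lt (half_lt_self (deriv_rectMap ha hb).1)
    filter_upwards [this] with s hs
    exact lt_trans (half_pos (deriv_rectMap ha hb).1) hs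
  have h3 : ∀ᶠ s : ℝ in 𝓝[>] 0, v * s ∈ symRect a b := by
    have : Tendsto (fun s : ℝ ↦ v * s) (𝓝[>] (0 : ℝ)) (𝓝 (0 : ℂ)) :=
      hpath.mono_right nhdsWithin_le_nhds
    exact this.eventually ((isOpen_symRect a b).mem_nhds (zero_mem_symRect ha hb))
  obtain ⟨s, ⟨hs2, hs3⟩, hs⟩ := ((h2.and h3).and self_mem_nhdsWithin).exists
  exact ⟨s, hs, hs3, hs2⟩

/-- **`g` maps the upper half of the rectangle into the upper half-disc** (Conway VII.4: a
conjugation-symmetric Riemann map is real exactly on the real axis): `Im g z > 0` for `Im z > 0`.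
[cite: Conway1978, Ch. VII Thm. 4.2] -/
theorem rectMap_im_pos (ha : 0 < a) (hb : 0 < b) {z : ℂ} (hz : z ∈ symRect a b) (hzim : 0 < z.im) :
    0 < (rectMap a b ha hb z).im := by
  set g := rectMap a b ha hb with hg
  set U : Set ℂ := symRect a b ∩ {z | 0 < z.im} with hU
  have hUc : IsPreconnected U := ((convex_symRect a b).inter (convex_halfSpace_im_gt 0)).isPreconnected
  have hUsub : U ⊆ symRect a b := inter_subset_left
  have himg : g '' U ⊆ {w : ℂ | 0 < w.im} ∪ {w : ℂ | w.im < 0} := by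
    rintro _ ⟨q, hq, rfl⟩
    rcases lt_trichotomy 0 (g q).im with h | h | h
    · exact Or.inl h
    · exfalso
      have h1 : conj (g q) = g q := conj_eq_iff_im.2 h.symm
      rw [← rectMap_conj ha hb (hUsub hq)] at h1
      have h2 := (rectMap a b ha hb).injOn (conj_mem_symRect.2 (hUsub hq)) (hUsub hq) h1
      have h3 : q.im = 0 := conj_eq_iff_im.1 h2
      exact absurd h3 (ne_of_gt hq.2)
    · exact Or.inr h
  have hpre : IsPreconnected (g '' U) := hUc.image _ (g.continuousOn.mono hUsub)
  rcases hpre.subset_or_subset (isOpen_lt continuous_const continuous_im)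
    (isOpen_lt continuous_im continuous_const)
    (Set.disjoint_left.2 fun w (h1 : 0 < w.im) (h2 : w.im < 0) ↦ lt_asymm h1 h2) himg with h | h
  · exact h ⟨z, ⟨hz, hzim⟩, rfl⟩
  · exfalso
    obtain ⟨s, hs, hsU, hre⟩ := exists_re_div_pos ha hb I_ne_zero
    have hmem : I * s ∈ U := ⟨hsU, by simpa using hs⟩
    have hneg : (g (I * s)).im < 0 := h ⟨_, hmem, rfl⟩
    have hne : I * (s : ℂ) ≠ 0 := mul_ne_zero I_ne_zero (ofReal_ne_zero.2 hs.ne')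
    have heq : g (I * s) = I * s * ((I * s)⁻¹ * g (I * s)) := by rw [← mul_assoc, mul_inv_cancel₀ hne, one_mul]
    rw [heq] at hneg
    have : (I * (s : ℂ) * ((I * s)⁻¹ * g (I * s))).im = s * ((I * s)⁻¹ * g (I * s)).re := by
      simp [mul_im, mul_re]
    rw [this] at hneg
    exact absurd (mul_pos hs hre) (not_lt.2 hneg.le)

/-- **`g` maps the right half of the rectangle into the right half-disc**: `Re g z > 0` for
`Re z > 0` (symmetry `g(-conj z) = -conj (g z)`). [cite: Conway1978, Ch. VII Thm. 4.2] -/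
theorem rectMap_re_pos (ha : 0 < a) (hb : 0 < b) {z : ℂ} (hz : z ∈ symRect a b) (hzre : 0 < z.re) :
    0 < (rectMap a b ha hb z).re := by
  set g := rectMap a b ha hb with hg
  set U : Set ℂ := symRect a b ∩ {z | 0 < z.re} with hU
  have hUc : IsPreconnected U := ((convex_symRect a b).inter (convex_halfSpace_re_gt 0)).isPreconnected
  have hUsub : U ⊆ symRect a b := inter_subset_left
  have himg : g '' U ⊆ {w : ℂ | 0 < w.re} ∪ {w : ℂ | w.re < 0} := by
    rintro _ ⟨q, hq, rfl⟩
    rcases lt_trichotomy 0 (g q).re with h | h | h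
    · exact Or.inl h
    · exfalso
      have h1 : -conj (g q) = g q := by
        apply Complex.ext <;> simp [h.symm]
      rw [← rectMap_neg_conj ha hb (hUsub hq)] at h1
      have h2 := (rectMap a b ha hb).injOn (neg_mem_symRect.2 (conj_mem_symRect.2 (hUsub hq))) (hUsub hq) h1
      have h3 : q.re = 0 := by
        have := congrArg Complex.re h2
        simp at this
        linarith
      exact absurd h3 (ne_of_gt hq.2)
    · exact Or.inr h
  have hpre : IsPreconnected (g '' U) := hUc.image _ (g.continuousOn.mono hUsub)
  rcases hpre.subset_or_subset (isOpen_lt continuous_const continuous_re)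
    (isOpen_lt continuous_re continuous_const)
    (Set.disjoint_left.2 fun w (h1 : 0 < w.re) (h2 : w.re < 0) ↦ lt_asymm h1 h2) himg with h | h
  · exact h ⟨z, ⟨hz, hzre⟩, rfl⟩
  · exfalso
    obtain ⟨s, hs, hsU, hre⟩ := exists_re_div_pos ha hb one_ne_zero
    rw [one_mul] at hsU hre
    have hmem : (s : ℂ) ∈ U := ⟨hsU, by simpa using hs⟩
    have hneg : (g s).re < 0 := h ⟨_, hmem, rfl⟩
    have hne : (s : ℂ) ≠ 0 := ofReal_ne_zero.2 hs.ne'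
    have heq : g s = s * ((s : ℂ)⁻¹ * g s) := by rw [← mul_assoc, mul_inv_cancel₀ hne, one_mul]
    rw [heq, re_ofReal_mul] at hneg
    exact absurd (mul_pos hs hre) (not_lt.2 hneg.le)

/-- The open quarter-rectangle `(0,a)×(0,b)` is mapped by `Φ = g` into the open first quadrant. [folklore] -/
theorem rectPhi_quarter (ha : 0 < a) (hb : 0 < b) :
    MapsTo (rectPhi a b ha hb) (Ioo 0 a ×ℂ Ioo 0 b) {w : ℂ | 0 < w.re ∧ 0 < w.im} := by
  intro z hz
  rw [mem_reProdIm] at hz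
  have hz' : z ∈ symRect a b := mem_symRect.2 ⟨⟨by linarith [hz.1.1], hz.1.2⟩, by linarith [hz.2.1], hz.2.2⟩
  rw [mem_setOf_eq, rectPhi_eq ha hb hz']
  exact ⟨rectMap_re_pos ha hb hz' hz.1.1, rectMap_im_pos ha hb hz' hz.2.1⟩

/-- The top-right corner `a + bi`. [folklore] -/
theorem corner_mem_frontier (ha : 0 < a) (hb : 0 < b) : (⟨a, b⟩ : ℂ) ∈ frontier (symRect a b) := by
  rw [mem_frontier_symRect ha hb]
  exact Or.inl ⟨⟨by linarith, le_rfl⟩, Or.inr rfl⟩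

/-- The corner lies in the closed rectangle. [folklore] -/
theorem corner_mem_closure (ha : 0 < a) (hb : 0 < b) : (⟨a, b⟩ : ℂ) ∈ closure (symRect a b) :=
  frontier_subset_closure (corner_mem_frontier ha hb)

/-- **The image of the top-right corner lies in the closed first quadrant** (it is a limit of images
of points of the open quarter-rectangle). [folklore] -/
theorem rectPhi_corner_nonneg (ha : 0 < a) (hb : 0 < b) :
    0 ≤ (rectPhi a b ha hb ⟨a, b⟩).re ∧ 0 ≤ (rectPhi a b ha hb ⟨a, b⟩).im := by
  have hQ : Ioo 0 a ×ℂ Ioo 0 b ⊆ closure (symRect a b) := fun z hz ↦ subset_closure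
    (mem_symRect.2 ⟨⟨by linarith [(mem_reProdIm.1 hz).1.1], (mem_reProdIm.1 hz).1.2⟩,
      by linarith [(mem_reProdIm.1 hz).2.1], (mem_reProdIm.1 hz).2.2⟩)
  have hc : (⟨a, b⟩ : ℂ) ∈ closure (Ioo 0 a ×ℂ Ioo 0 b) := by
    rw [closure_reProdIm, closure_Ioo ha.ne, closure_Ioo hb.ne, mem_reProdIm]
    exact ⟨⟨ha.le, le_rfl⟩, hb.le, le_rfl⟩
  have hcont : ContinuousWithinAt (rectPhi a b ha hb) (Ioo 0 a ×ℂ Ioo 0 b) ⟨a, b⟩ :=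
    ((continuousOn_rectPhi ha hb) _ (corner_mem_closure ha hb)).mono hQ
  have hmem := hcont.mem_closure hc (rectPhi_quarter ha hb)
  have hsub : closure {w : ℂ | 0 < w.re ∧ 0 < w.im} ⊆ {w : ℂ | 0 ≤ w.re} ∩ {w : ℂ | 0 ≤ w.im} := by
    have h1 : {w : ℂ | 0 < w.re ∧ 0 < w.im} = {w : ℂ | 0 < w.re} ∩ {w : ℂ | 0 < w.im} := rfl
    rw [h1, ← closure_setOf_lt_re, ← closure_setOf_lt_im]
    exact closure_inter_subset_inter_closure _ _
  exact hsub hmem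

/-- The image of the corner is off both axes (the four corners have four distinct images
`ζ₀, conj ζ₀, -ζ₀, -conj ζ₀`). [folklore] -/
theorem rectPhi_corner_ne (ha : 0 < a) (hb : 0 < b) :
    (rectPhi a b ha hb ⟨a, b⟩).re ≠ 0 ∧ (rectPhi a b ha hb ⟨a, b⟩).im ≠ 0 := by
  have hc := corner_mem_closure ha hb
  constructor
  · intro h
    have h1 : -conj (rectPhi a b ha hb ⟨a, b⟩) = rectPhi a b ha hb ⟨a, b⟩ := by
      apply Complex.ext <;> simp [h]
    rw [← rectPhi_neg_conj ha hb hc] at h1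
    have h2 := injOn_rectPhi ha hb ((neg_mem_closure_symRect ha hb).2 ((conj_mem_closure_symRect ha hb).2 hc)) hc h1
    have := congrArg Complex.re h2
    simp at this
    linarith
  · intro h
    have h1 : conj (rectPhi a b ha hb ⟨a, b⟩) = rectPhi a b ha hb ⟨a, b⟩ := conj_eq_iff_im.2 h
    rw [← rectPhi_conj ha hb hc] at h1
    have h2 := injOn_rectPhi ha hb ((conj_mem_closure_symRect ha hb).2 hc) hc h1
    have := congrArg Complex.im h2
    simp at this
    linarith

/-- **The corner angle `θ` of the rectangle**: `Φ(a + bi) = e^{iθ}`, i.e. `2θ/2π` is the harmonic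
measure at the centre of the right side `{a} × (-b, b)` (and `(π - 2θ)/2π` that of the top side).
[folklore] -/
def rectTheta (a b : ℝ) (ha : 0 < a) (hb : 0 < b) : ℝ :=
  arg (rectPhi a b ha hb ⟨a, b⟩)

/-- **`0 < θ < π/2`.** [folklore] -/
theorem rectTheta_mem (ha : 0 < a) (hb : 0 < b) : rectTheta a b ha hb ∈ Ioo 0 (π / 2) := by
  obtain ⟨hre, him⟩ := rectPhi_corner_nonneg ha hb
  obtain ⟨hre', him'⟩ := rectPhi_corner_ne ha hb
  have hn : ‖rectPhi a b ha hb ⟨a, b⟩‖ = 1 := norm_rectPhi ha hb (corner_mem_frontier ha hb)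
  rw [rectTheta, arg_of_re_nonneg hre, hn, div_one]
  refine ⟨Real.arcsin_pos.2 (lt_of_le_of_ne him (Ne.symm him')), Real.arcsin_lt_pi_div_two.2 ?_⟩
  -- `im < 1` since `re ≠ 0` and `re² + im² = 1`
  have h1 : (rectPhi a b ha hb ⟨a, b⟩).re ^ 2 + (rectPhi a b ha hb ⟨a, b⟩).im ^ 2 = 1 := by
    have := Complex.sq_norm (rectPhi a b ha hb ⟨a, b⟩)
    rw [hn, Complex.normSq_apply] at this
    nlinarith
  nlinarith [sq_pos_of_ne_zero hre']

/-- **`Φ(a + bi) = e^{iθ}`.** [folklore] -/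
theorem rectPhi_corner (ha : 0 < a) (hb : 0 < b) :
    rectPhi a b ha hb ⟨a, b⟩ = exp (rectTheta a b ha hb * I) := by
  have h := norm_mul_exp_arg_mul_I (rectPhi a b ha hb ⟨a, b⟩)
  rw [norm_rectPhi ha hb (corner_mem_frontier ha hb), ofReal_one, one_mul] at h
  exact h.symm

/-- `Φ(a - bi) = e^{-iθ}` (bottom-right corner). [folklore] -/
theorem rectPhi_corner_br (ha : 0 < a) (hb : 0 < b) :
    rectPhi a b ha hb ⟨a, -b⟩ = exp (-(rectTheta a b ha hb : ℂ) * I) := by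
  have h1 : (⟨a, -b⟩ : ℂ) = conj ⟨a, b⟩ := by apply Complex.ext <;> simp
  rw [h1, rectPhi_conj ha hb (corner_mem_closure ha hb), rectPhi_corner ha hb, ← exp_conj,
    map_mul, conj_ofReal, conj_I, mul_neg, neg_mul]

/-- `Φ(-a + bi) = e^{i(π - θ)}` (top-left corner). [folklore] -/
theorem rectPhi_corner_tl (ha : 0 < a) (hb : 0 < b) :
    rectPhi a b ha hb ⟨-a, b⟩ = exp ((π - rectTheta a b ha hb : ℝ) * I) := by
  have h1 : (⟨-a, b⟩ : ℂ) = -conj ⟨a, b⟩ := by apply Complex.ext <;> simp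
  rw [h1, rectPhi_neg_conj ha hb (corner_mem_closure ha hb), rectPhi_corner ha hb, ← exp_conj,
    map_mul, conj_ofReal, conj_I, ofReal_sub, sub_mul, Complex.exp_sub, exp_pi_mul_I]
  rw [mul_neg, Complex.exp_neg]
  field_simp

/-- `Φ(-a - bi) = -e^{iθ}` (bottom-left corner). [folklore] -/
theorem rectPhi_corner_bl (ha : 0 < a) (hb : 0 < b) :
    rectPhi a b ha hb ⟨-a, -b⟩ = -exp (rectTheta a b ha hb * I) := by
  have h1 : (⟨-a, -b⟩ : ℂ) = -⟨a, b⟩ := by apply Complex.ext <;> simp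
  rw [h1, rectPhi_neg ha hb (corner_mem_closure ha hb), rectPhi_corner ha hb]

end Corner


/-! ### The sides of the rectangle and the arcs of the circle -/

section Sides

/-- The real point `a` (midpoint of the right side) is on the frontier. [folklore] -/
theorem ofReal_mem_frontier_symRect (ha : 0 < a) (hb : 0 < b) : (a : ℂ) ∈ frontier (symRect a b) := by
  rw [mem_frontier_symRect ha hb]
  exact Or.inr ⟨Or.inr (ofReal_re a), by simp; exact hb.le, by simp; exact hb.le⟩

/-- **`Φ(a) = 1`**: the midpoint of the right side goes to `1` (`Φ(a)` is real by the conjugation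
symmetry, of modulus one, with non-negative real part). [folklore] -/
theorem rectPhi_ofReal (ha : 0 < a) (hb : 0 < b) : rectPhi a b ha hb a = 1 := by
  set ζ := rectPhi a b ha hb a with hζ
  have hfr := ofReal_mem_frontier_symRect ha hb
  have hcl : (a : ℂ) ∈ closure (symRect a b) := frontier_subset_closure hfr
  have hn : ‖ζ‖ = 1 := norm_rectPhi ha hb hfr
  have him : ζ.im = 0 := by
    have h := rectPhi_conj ha hb hcl
    rw [conj_ofReal] at h
    exact conj_eq_iff_im.1 h.symm
  have hre : 0 ≤ ζ.re := by
    have hQ : Ioo 0 a ×ℂ Ioo (-b) b ⊆ symRect a b := fun z hz ↦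
      mem_symRect.2 ⟨⟨by linarith [(mem_reProdIm.1 hz).1.1], (mem_reProdIm.1 hz).1.2⟩, (mem_reProdIm.1 hz).2⟩
    have hc : (a : ℂ) ∈ closure (Ioo 0 a ×ℂ Ioo (-b) b) := by
      rw [closure_reProdIm, closure_Ioo ha.ne, closure_Ioo (by linarith), mem_reProdIm]
      exact ⟨⟨ha.le, le_rfl⟩, by simp; exact hb.le, by simp; exact hb.le⟩
    have hcont : ContinuousWithinAt (rectPhi a b ha hb) (Ioo 0 a ×ℂ Ioo (-b) b) a :=
      ((continuousOn_rectPhi ha hb) _ hcl).mono fun z hz ↦ subset_closure (hQ hz)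
    have hmaps : MapsTo (rectPhi a b ha hb) (Ioo 0 a ×ℂ Ioo (-b) b) {w : ℂ | 0 < w.re} := by
      intro z hz
      rw [mem_setOf_eq, rectPhi_eq ha hb (hQ hz)]
      exact rectMap_re_pos ha hb (hQ hz) (mem_reProdIm.1 hz).1.1
    have hmem := hcont.mem_closure hc hmaps
    rw [closure_setOf_lt_re] at hmem
    exact hmem
  have h1 : ζ.re ^ 2 + ζ.im ^ 2 = 1 := by
    have := Complex.sq_norm ζ
    rw [hn, Complex.normSq_apply] at this
    nlinarith
  rw [him] at h1
  have hre1 : ζ.re = 1 := by nlinarith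
  exact Complex.ext (by simpa using hre1) (by simpa using him)

/-- `Φ(-a) = -1` (midpoint of the left side). [folklore] -/
theorem rectPhi_neg_ofReal (ha : 0 < a) (hb : 0 < b) : rectPhi a b ha hb (-a) = -1 := by
  rw [rectPhi_neg ha hb (frontier_subset_closure (ofReal_mem_frontier_symRect ha hb)), rectPhi_ofReal ha hb]

/-- A point of the closed rectangle other than `-a` is not mapped to `-1`. [folklore] -/
theorem rectPhi_ne_neg_one (ha : 0 < a) (hb : 0 < b) {p : ℂ} (hp : p ∈ closure (symRect a b))
    (hpa : p ≠ -a) : rectPhi a b ha hb p ≠ -1 := by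
  intro h
  rw [← rectPhi_neg_ofReal ha hb] at h
  exact hpa (injOn_rectPhi ha hb hp
    ((neg_mem_closure_symRect ha hb).2 (frontier_subset_closure (ofReal_mem_frontier_symRect ha hb))) h)

/-- **The angular parameter `arg Φ` along a boundary arc is continuous and injective**, hence
strictly monotone or antitone: for a continuous injective path `p : [s₀, s₁] → ∂R` avoiding the
point `-a` (the preimage of `-1`). [folklore] -/
theorem continuousOn_injOn_arg_rectPhi (ha : 0 < a) (hb : 0 < b) {p : ℝ → ℂ} {s₀ s₁ : ℝ}
    (hpc : ContinuousOn p (Icc s₀ s₁)) (hpi : InjOn p (Icc s₀ s₁))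
    (hpf : MapsTo p (Icc s₀ s₁) (frontier (symRect a b))) (hpa : ∀ s ∈ Icc s₀ s₁, p s ≠ -a) :
    ContinuousOn (fun s ↦ arg (rectPhi a b ha hb (p s))) (Icc s₀ s₁) ∧
      InjOn (fun s ↦ arg (rectPhi a b ha hb (p s))) (Icc s₀ s₁) := by
  constructor
  · intro s hs
    have h1 : ContinuousWithinAt (fun s ↦ rectPhi a b ha hb (p s)) (Icc s₀ s₁) s :=
      ((continuousOn_rectPhi ha hb).comp hpc (hpf.mono_right frontier_subset_closure)) s hs
    -- a unit complex number other than `-1` lies in the slit plane, where `arg` is continuous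
    -- (cf. `Literature.Topology.FourManifolds.mem_slitPlane_of_norm_eq_one`)
    have hslit : rectPhi a b ha hb (p s) ∈ slitPlane := by
      have hz := norm_rectPhi ha hb (hpf hs)
      have hne := rectPhi_ne_neg_one ha hb (frontier_subset_closure (hpf hs)) (hpa s hs)
      rw [mem_slitPlane_iff]
      by_contra h
      push Not at h
      obtain ⟨hre, him⟩ := h
      have h1 : (rectPhi a b ha hb (p s)).re ^ 2 + (rectPhi a b ha hb (p s)).im ^ 2 = 1 := by
        have := Complex.sq_norm (rectPhi a b ha hb (p s))
        rw [hz, Complex.normSq_apply] at this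
        nlinarith
      rw [him] at h1
      have hre1 : (rectPhi a b ha hb (p s)).re = -1 := by nlinarith
      exact hne (Complex.ext (by simpa using hre1) (by simpa using him))
    have h2 : ContinuousAt arg (rectPhi a b ha hb (p s)) := continuousAt_arg hslit
    exact ContinuousAt.comp_continuousWithinAt (g := arg) (f := fun s ↦ rectPhi a b ha hb (p s)) h2 h1
  · intro s hs s' hs' h
    have h1 : rectPhi a b ha hb (p s) = rectPhi a b ha hb (p s') :=
      ext_norm_arg (by rw [norm_rectPhi ha hb (hpf hs), norm_rectPhi ha hb (hpf hs')]) h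
    exact hpi hs hs' (injOn_rectPhi ha hb (frontier_subset_closure (hpf hs))
      (frontier_subset_closure (hpf hs')) h1)

/-- `Φ(p) = e^{i arg Φ(p)}` on the frontier. [folklore] -/
theorem rectPhi_eq_exp_arg (ha : 0 < a) (hb : 0 < b) {p : ℂ} (hp : p ∈ frontier (symRect a b)) :
    rectPhi a b ha hb p = exp (arg (rectPhi a b ha hb p) * I) := by
  have h := norm_mul_exp_arg_mul_I (rectPhi a b ha hb p)
  rw [norm_rectPhi ha hb hp, ofReal_one, one_mul] at h
  exact h.symm

/-- **The top side.** The angular parameter `x ↦ arg Φ(x + bi)` on `[-a, a]`. [folklore] -/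
def topArg (a b : ℝ) (ha : 0 < a) (hb : 0 < b) (x : ℝ) : ℝ :=
  arg (rectPhi a b ha hb ⟨x, b⟩)

/-- Points of the closed top side are on the frontier. [folklore] -/
theorem top_mem_frontier (ha : 0 < a) (hb : 0 < b) {x : ℝ} (hx : x ∈ Icc (-a) a) :
    (⟨x, b⟩ : ℂ) ∈ frontier (symRect a b) := by
  rw [mem_frontier_symRect ha hb]; exact Or.inl ⟨hx, Or.inr rfl⟩

/-- `arg Φ` is continuous and injective along the top side. [folklore] -/
theorem continuousOn_injOn_topArg (ha : 0 < a) (hb : 0 < b) :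
    ContinuousOn (topArg a b ha hb) (Icc (-a) a) ∧ InjOn (topArg a b ha hb) (Icc (-a) a) := by
  have hp : (fun x : ℝ ↦ (⟨x, b⟩ : ℂ)) = fun x : ℝ ↦ (x : ℂ) + b * I := by
    funext x; apply Complex.ext <;> simp
  refine continuousOn_injOn_arg_rectPhi ha hb (p := fun x : ℝ ↦ (⟨x, b⟩ : ℂ)) ?_ ?_
    (fun x hx ↦ top_mem_frontier ha hb hx) ?_
  · rw [hp]; fun_prop
  · intro x _ y _ h; simpa using congrArg Complex.re h
  · intro x _ h
    have := congrArg Complex.im h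
    simp at this
    exact hb.ne' this

/-- `topArg a = θ`. [folklore] -/
theorem topArg_right (ha : 0 < a) (hb : 0 < b) : topArg a b ha hb a = rectTheta a b ha hb := rfl

/-- `topArg (-a) = π - θ`. [folklore] -/
theorem topArg_left (ha : 0 < a) (hb : 0 < b) : topArg a b ha hb (-a) = π - rectTheta a b ha hb := by
  have hθ := rectTheta_mem ha hb
  rw [topArg, rectPhi_corner_tl ha hb, arg_exp_mul_I,
    toIocMod_eq_self Real.two_pi_pos |>.2 ⟨by linarith [hθ.1, hθ.2], by linarith [hθ.1]⟩]

/-- **`arg Φ` decreases strictly from `π - θ` to `θ` along the top side `[-a, a] × {b}`.** [folklore] -/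
theorem strictAntiOn_topArg (ha : 0 < a) (hb : 0 < b) : StrictAntiOn (topArg a b ha hb) (Icc (-a) a) := by
  obtain ⟨hc, hi⟩ := continuousOn_injOn_topArg ha hb
  have hθ := rectTheta_mem ha hb
  refine hc.strictAntiOn_of_injOn_Icc (by linarith) ?_ hi
  rw [topArg_right, topArg_left]
  linarith [hθ.2]

/-- **The open top side is mapped into the open arc `(θ, π - θ)`**: for `-a < x < a`,
`Φ(x + bi) = e^{it}` with `t = topArg x ∈ (θ, π - θ)`. [folklore] -/
theorem topArg_mem (ha : 0 < a) (hb : 0 < b) {x : ℝ} (hx : x ∈ Ioo (-a) a) :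
    topArg a b ha hb x ∈ Ioo (rectTheta a b ha hb) (π - rectTheta a b ha hb) ∧
      rectPhi a b ha hb ⟨x, b⟩ = exp (topArg a b ha hb x * I) := by
  have hanti := strictAntiOn_topArg ha hb
  refine ⟨⟨?_, ?_⟩, rectPhi_eq_exp_arg ha hb (top_mem_frontier ha hb (Ioo_subset_Icc_self hx))⟩
  · rw [← topArg_right ha hb]
    exact hanti (Ioo_subset_Icc_self hx) (right_mem_Icc.2 (by linarith)) hx.2
  · rw [← topArg_left ha hb]
    exact hanti (left_mem_Icc.2 (by linarith)) (Ioo_subset_Icc_self hx) hx.1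

/-- **The open arc `(θ, π - θ)` is mapped onto the open top side**: for `θ < t < π - θ` there is
`-a < x < a` with `Φ(x + bi) = e^{it}`, i.e. `Ψ(e^{it}) = x + bi`. [folklore] -/
theorem exists_top_of_mem_arc (ha : 0 < a) (hb : 0 < b) {t : ℝ}
    (ht : t ∈ Ioo (rectTheta a b ha hb) (π - rectTheta a b ha hb)) :
    ∃ x ∈ Ioo (-a) a, rectPhi a b ha hb ⟨x, b⟩ = exp (t * I) ∧ rectPsi a b ha hb (exp (t * I)) = ⟨x, b⟩ := by
  obtain ⟨hc, -⟩ := continuousOn_injOn_topArg ha hb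
  have hivt := intermediate_value_Icc' (show -a ≤ a by linarith) hc
  rw [topArg_right, topArg_left] at hivt
  obtain ⟨x, hx, hxt⟩ := hivt (Ioo_subset_Icc_self ht)
  have hx' : x ∈ Ioo (-a) a := by
    refine ⟨lt_of_le_of_ne hx.1 ?_, lt_of_le_of_ne hx.2 ?_⟩
    · rintro rfl; rw [topArg_left] at hxt; exact ht.2.ne hxt.symm
    · rintro rfl; rw [topArg_right] at hxt; exact ht.1.ne hxt
  have hΦ : rectPhi a b ha hb ⟨x, b⟩ = exp (t * I) := by rw [(topArg_mem ha hb hx').2, hxt]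
  refine ⟨x, hx', hΦ, ?_⟩
  rw [← hΦ, rectPsi_rectPhi ha hb (frontier_subset_closure (top_mem_frontier ha hb hx))]

/-- **The right side.** The angular parameter `y ↦ arg Φ(a + yi)` on `[-b, b]`. [folklore] -/
def rightArg (a b : ℝ) (ha : 0 < a) (hb : 0 < b) (y : ℝ) : ℝ :=
  arg (rectPhi a b ha hb ⟨a, y⟩)

/-- Points of the closed right side are on the frontier. [folklore] -/
theorem right_mem_frontier (ha : 0 < a) (hb : 0 < b) {y : ℝ} (hy : y ∈ Icc (-b) b) :
    (⟨a, y⟩ : ℂ) ∈ frontier (symRect a b) := by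
  rw [mem_frontier_symRect ha hb]; exact Or.inr ⟨Or.inr rfl, hy⟩

/-- `arg Φ` is continuous and injective along the right side. [folklore] -/
theorem continuousOn_injOn_rightArg (ha : 0 < a) (hb : 0 < b) :
    ContinuousOn (rightArg a b ha hb) (Icc (-b) b) ∧ InjOn (rightArg a b ha hb) (Icc (-b) b) := by
  have hp : (fun y : ℝ ↦ (⟨a, y⟩ : ℂ)) = fun y : ℝ ↦ (a : ℂ) + y * I := by
    funext y; apply Complex.ext <;> simp
  refine continuousOn_injOn_arg_rectPhi ha hb (p := fun y : ℝ ↦ (⟨a, y⟩ : ℂ)) ?_ ?_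
    (fun y hy ↦ right_mem_frontier ha hb hy) ?_
  · rw [hp]; fun_prop
  · intro x _ y _ h; simpa using congrArg Complex.im h
  · intro y _ h
    have := congrArg Complex.re h
    simp at this
    linarith

/-- `rightArg b = θ`. [folklore] -/
theorem rightArg_top (ha : 0 < a) (hb : 0 < b) : rightArg a b ha hb b = rectTheta a b ha hb := rfl

/-- `rightArg (-b) = -θ`. [folklore] -/
theorem rightArg_bot (ha : 0 < a) (hb : 0 < b) : rightArg a b ha hb (-b) = -rectTheta a b ha hb := by
  have hθ := rectTheta_mem ha hb
  rw [rightArg, rectPhi_corner_br ha hb, show -(rectTheta a b ha hb : ℂ) * I =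
    ((-rectTheta a b ha hb : ℝ) : ℂ) * I by push_cast; ring, arg_exp_mul_I,
    toIocMod_eq_self Real.two_pi_pos |>.2 ⟨by linarith [hθ.1, hθ.2], by linarith [hθ.1, hθ.2]⟩]

/-- **`arg Φ` increases strictly from `-θ` to `θ` along the right side `{a} × [-b, b]`.** [folklore] -/
theorem strictMonoOn_rightArg (ha : 0 < a) (hb : 0 < b) :
    StrictMonoOn (rightArg a b ha hb) (Icc (-b) b) := by
  obtain ⟨hc, hi⟩ := continuousOn_injOn_rightArg ha hb
  have hθ := rectTheta_mem ha hb
  refine hc.strictMonoOn_of_injOn_Icc (by linarith) ?_ hi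
  rw [rightArg_top, rightArg_bot]
  linarith [hθ.1]

/-- **The open right side is mapped into the open arc `(-θ, θ)`.** [folklore] -/
theorem rightArg_mem (ha : 0 < a) (hb : 0 < b) {y : ℝ} (hy : y ∈ Ioo (-b) b) :
    rightArg a b ha hb y ∈ Ioo (-rectTheta a b ha hb) (rectTheta a b ha hb) ∧
      rectPhi a b ha hb ⟨a, y⟩ = exp (rightArg a b ha hb y * I) := by
  have hmono := strictMonoOn_rightArg ha hb
  refine ⟨⟨?_, ?_⟩, rectPhi_eq_exp_arg ha hb (right_mem_frontier ha hb (Ioo_subset_Icc_self hy))⟩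
  · rw [← rightArg_bot ha hb]
    exact hmono (left_mem_Icc.2 (by linarith)) (Ioo_subset_Icc_self hy) hy.1
  · rw [← rightArg_top ha hb]
    exact hmono (Ioo_subset_Icc_self hy) (right_mem_Icc.2 (by linarith)) hy.2

/-- **The open arc `(-θ, θ)` is mapped onto the open right side**: for `-θ < t < θ` there is
`-b < y < b` with `Φ(a + yi) = e^{it}`, i.e. `Ψ(e^{it}) = a + yi`. [folklore] -/
theorem exists_right_of_mem_arc (ha : 0 < a) (hb : 0 < b) {t : ℝ}
    (ht : t ∈ Ioo (-rectTheta a b ha hb) (rectTheta a b ha hb)) :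
    ∃ y ∈ Ioo (-b) b, rectPhi a b ha hb ⟨a, y⟩ = exp (t * I) ∧ rectPsi a b ha hb (exp (t * I)) = ⟨a, y⟩ := by
  obtain ⟨hc, -⟩ := continuousOn_injOn_rightArg ha hb
  have hivt := intermediate_value_Icc (show -b ≤ b by linarith) hc
  rw [rightArg_top, rightArg_bot] at hivt
  obtain ⟨y, hy, hyt⟩ := hivt (Ioo_subset_Icc_self ht)
  have hy' : y ∈ Ioo (-b) b := by
    refine ⟨lt_of_le_of_ne hy.1 ?_, lt_of_le_of_ne hy.2 ?_⟩
    · rintro rfl; rw [rightArg_bot] at hyt; exact ht.1.ne hyt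
    · rintro rfl; rw [rightArg_top] at hyt; exact ht.2.ne hyt.symm
  have hΦ : rectPhi a b ha hb ⟨a, y⟩ = exp (t * I) := by rw [(rightArg_mem ha hb hy').2, hyt]
  refine ⟨y, hy', hΦ, ?_⟩
  rw [← hΦ, rectPsi_rectPhi ha hb (frontier_subset_closure (right_mem_frontier ha hb hy))]

end Sides


/-! ### The corner preimages under `Ψ`; transport under similarities; symmetry `θ(b,a) = π/2 - θ(a,b)` -/

section Transport

/-- `Ψ(e^{iθ}) = a + bi`. [folklore] -/
theorem rectPsi_exp_theta (ha : 0 < a) (hb : 0 < b) :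
    rectPsi a b ha hb (exp (rectTheta a b ha hb * I)) = ⟨a, b⟩ := by
  rw [← rectPhi_corner ha hb, rectPsi_rectPhi ha hb (corner_mem_closure ha hb)]

/-- `Ψ(conj e^{iθ}) = a - bi`. [folklore] -/
theorem rectPsi_conj_exp_theta (ha : 0 < a) (hb : 0 < b) :
    rectPsi a b ha hb (conj (exp (rectTheta a b ha hb * I))) = ⟨a, -b⟩ := by
  rw [← rectPhi_corner ha hb, ← rectPhi_conj ha hb (corner_mem_closure ha hb),
    rectPsi_rectPhi ha hb ((conj_mem_closure_symRect ha hb).2 (corner_mem_closure ha hb))]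
  apply Complex.ext <;> simp

/-- `Ψ(-e^{iθ}) = -a - bi`. [folklore] -/
theorem rectPsi_neg_exp_theta (ha : 0 < a) (hb : 0 < b) :
    rectPsi a b ha hb (-exp (rectTheta a b ha hb * I)) = ⟨-a, -b⟩ := by
  rw [← rectPhi_corner ha hb, ← rectPhi_neg ha hb (corner_mem_closure ha hb),
    rectPsi_rectPhi ha hb ((neg_mem_closure_symRect ha hb).2 (corner_mem_closure ha hb))]
  apply Complex.ext <;> simp

/-- `Ψ(-conj e^{iθ}) = -a + bi`. [folklore] -/
theorem rectPsi_neg_conj_exp_theta (ha : 0 < a) (hb : 0 < b) :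
    rectPsi a b ha hb (-conj (exp (rectTheta a b ha hb * I))) = ⟨-a, b⟩ := by
  rw [← rectPhi_corner ha hb, ← rectPhi_neg_conj ha hb (corner_mem_closure ha hb),
    rectPsi_rectPhi ha hb ((neg_mem_closure_symRect ha hb).2 ((conj_mem_closure_symRect ha hb).2
      (corner_mem_closure ha hb)))]
  apply Complex.ext <;> simp

variable {a' b' : ℝ}

/-- **Transport of the boundary correspondence under a similarity.** If `z ↦ c z` maps the rectangle
`R' = (-a',a')×(-b',b')` onto `R = (-a,a)×(-b,b)` and `η c > 0` for a unit `η`, then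
`z ↦ η g(c z)` is the normalised Riemann map of `R'` (uniqueness), its inverse extends by
`w ↦ c⁻¹ Ψ(η⁻¹ w)`, and so `Φ'(p) = η Φ(c p)` on the closed rectangle `R'`. Used with
`c = λ⁻¹, η = 1` (dilations) and `c = -i, η = i` (the quarter turn). [folklore] -/
theorem rectPhi_transport (ha : 0 < a) (hb : 0 < b) (ha' : 0 < a') (hb' : 0 < b') {c η : ℂ}
    (hc : c ≠ 0) (hη : ‖η‖ = 1) {r : ℝ} (hr : 0 < r) (hηc : η * c = r)
    (hmem : ∀ z, z ∈ symRect a' b' ↔ c * z ∈ symRect a b) {p : ℂ} (hp : p ∈ closure (symRect a' b')) :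
    rectPhi a' b' ha' hb' p = η * rectPhi a b ha hb (c * p) := by
  set g := rectMap a b ha hb with hg
  set g' := rectMap a' b' ha' hb' with hg'
  have hη0 : η ≠ 0 := norm_ne_zero_iff.1 (by rw [hη]; exact one_ne_zero)
  have hmem' : ∀ z, z ∈ symRect a' b' ↔ c * z + 0 ∈ symRect a b := fun z ↦ by rw [add_zero]; exact hmem z
  set ψ := (g.precompAffine c 0 hc (symRect a' b') hmem').trans (rotBall η hη) with hψ
  have hψapp : ∀ z, ψ z = η * g (c * z) := fun z ↦ by
    rw [hψ, ConformalEquiv.trans_apply, rotBall_apply, ConformalEquiv.precompAffine_apply, add_zero]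
  -- `ψ` is normalised, hence `ψ = g'`
  have hψ0 : ψ 0 = 0 := by rw [hψapp, mul_zero, hg, rectMap_zero ha hb, mul_zero]
  have hd : HasDerivAt ψ (η * c * deriv g 0) 0 := by
    have h1 : (ψ : ℂ → ℂ) = fun z ↦ η * g (c * z) := funext hψapp
    have h2 : HasDerivAt g (deriv g 0) (c * 0) := by rw [mul_zero]; exact hasDerivAt_rectMap ha hb
    have h3 := ((h2.comp 0 ((hasDerivAt_id 0).const_mul c)).const_mul η)
    rw [h1]
    simp only [Function.comp_def] at h3
    exact h3.congr_deriv (by ring)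
  have hd' : deriv ψ 0 = r * deriv g 0 := by rw [hd.deriv, hηc]
  have hre : 0 < (deriv ψ 0).re := by
    rw [hd', re_ofReal_mul]; exact mul_pos hr (deriv_rectMap ha hb).1
  have him : (deriv ψ 0).im = 0 := by rw [hd', im_ofReal_mul, (deriv_rectMap ha hb).2, mul_zero]
  have hEq : EqOn ψ g' (symRect a' b') := rectMap_unique ha' hb' ψ hψ0 hre him
  -- the continuous extension of `g'⁻¹`
  set Ψ'' : ℂ → ℂ := fun w ↦ c⁻¹ * rectPsi a b ha hb (η⁻¹ * w) with hΨ''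
  have hηinv : ∀ w, ‖η⁻¹ * w‖ = ‖w‖ := fun w ↦ by rw [norm_mul, norm_inv, hη, inv_one, one_mul]
  have hΨ''c : ContinuousOn Ψ'' (closedBall 0 1) := by
    refine ContinuousOn.mul continuousOn_const ((continuousOn_rectPsi ha hb).comp (by fun_prop) ?_)
    intro w hw
    rw [mem_closedBall_zero_iff] at hw ⊢
    rwa [hηinv]
  have hΨ''eq : EqOn Ψ'' g'.symm (ball 0 1) := by
    intro w hw
    have hw' : η⁻¹ * w ∈ ball (0 : ℂ) 1 := by rw [mem_ball_zero_iff] at hw ⊢; rwa [hηinv]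
    have hq : Ψ'' w ∈ symRect a' b' := by
      rw [hmem, hΨ'', mul_inv_cancel_left₀ hc]
      exact rectPsi_mem_symRect ha hb hw'
    have h1 : g' (Ψ'' w) = w := by
      rw [← hEq hq, hψapp, hΨ'', mul_inv_cancel_left₀ hc, rectPsi_eqOn ha hb hw',
        g.apply_symm_apply hw', mul_inv_cancel_left₀ hη0]
    rw [← h1, g'.symm_apply_apply hq, h1]
  have hΨ' : EqOn Ψ'' (rectPsi a' b' ha' hb') (closedBall 0 1) := rectPsi_unique ha' hb' hΨ''c hΨ''eq
  -- read off `Φ'`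
  set ζ := rectPhi a' b' ha' hb' p with hζ
  have hζmem : ζ ∈ closedBall (0 : ℂ) 1 := mapsTo_rectPhi ha' hb' hp
  have hζ' : η⁻¹ * ζ ∈ closedBall (0 : ℂ) 1 := by
    rw [mem_closedBall_zero_iff] at hζmem ⊢; rwa [hηinv]
  have h1 : p = Ψ'' ζ := by
    rw [hΨ' hζmem, hζ, rectPsi_rectPhi ha' hb' hp]
  have h2 : c * p = rectPsi a b ha hb (η⁻¹ * ζ) := by
    rw [h1, hΨ'']
    simp only
    rw [mul_inv_cancel_left₀ hc]
  rw [h2, rectPhi_rectPsi ha hb hζ', mul_inv_cancel_left₀ hη0]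

/-- **Scale invariance of the corner angle**: `θ(λa, λb) = θ(a, b)`. [folklore] -/
theorem rectTheta_smul (ha : 0 < a) (hb : 0 < b) {t : ℝ} (ht : 0 < t) :
    rectTheta (t * a) (t * b) (mul_pos ht ha) (mul_pos ht hb) = rectTheta a b ha hb := by
  have hc : ((t⁻¹ : ℝ) : ℂ) ≠ 0 := ofReal_ne_zero.2 (inv_ne_zero ht.ne')
  have hmem : ∀ z, z ∈ symRect (t * a) (t * b) ↔ ((t⁻¹ : ℝ) : ℂ) * z ∈ symRect a b := by
    intro z
    simp only [mem_symRect, re_ofReal_mul, im_ofReal_mul]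
    constructor
    · rintro ⟨⟨h1, h2⟩, h3, h4⟩
      refine ⟨⟨?_, ?_⟩, ?_, ?_⟩
      · have := mul_lt_mul_of_pos_left h1 (inv_pos.2 ht); rw [mul_neg, ← mul_assoc, inv_mul_cancel₀ ht.ne', one_mul] at this; exact this
      · have := mul_lt_mul_of_pos_left h2 (inv_pos.2 ht); rw [← mul_assoc, inv_mul_cancel₀ ht.ne', one_mul] at this; exact this
      · have := mul_lt_mul_of_pos_left h3 (inv_pos.2 ht); rw [mul_neg, ← mul_assoc, inv_mul_cancel₀ ht.ne', one_mul] at this; exact this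
      · have := mul_lt_mul_of_pos_left h4 (inv_pos.2 ht); rw [← mul_assoc, inv_mul_cancel₀ ht.ne', one_mul] at this; exact this
    · rintro ⟨⟨h1, h2⟩, h3, h4⟩
      refine ⟨⟨?_, ?_⟩, ?_, ?_⟩
      · have := mul_lt_mul_of_pos_left h1 ht; rw [← mul_assoc, mul_inv_cancel₀ ht.ne', one_mul] at this; linarith
      · have := mul_lt_mul_of_pos_left h2 ht; rw [← mul_assoc, mul_inv_cancel₀ ht.ne', one_mul] at this; linarith
      · have := mul_lt_mul_of_pos_left h3 ht; rw [← mul_assoc, mul_inv_cancel₀ ht.ne', one_mul] at this; linarith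
      · have := mul_lt_mul_of_pos_left h4 ht; rw [← mul_assoc, mul_inv_cancel₀ ht.ne', one_mul] at this; linarith
  have h := rectPhi_transport ha hb (mul_pos ht ha) (mul_pos ht hb) hc (η := 1) (by simp)
    (r := t⁻¹) (inv_pos.2 ht) (by rw [one_mul]) hmem (corner_mem_closure (mul_pos ht ha) (mul_pos ht hb))
  have hcorner : ((t⁻¹ : ℝ) : ℂ) * (⟨t * a, t * b⟩ : ℂ) = ⟨a, b⟩ := by
    apply Complex.ext <;> simp <;> field_simp
  rw [rectTheta, rectTheta, h, one_mul, hcorner]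

/-- **The quarter turn**: `θ(b, a) = π/2 - θ(a, b)` (the rectangle `(-b,b)×(-a,a)` is
`i · ((-a,a)×(-b,b))`, its Riemann map is `z ↦ i g(-iz)`, and the corner `b + ai` corresponds to
`i Φ(a - bi) = i e^{-iθ} = e^{i(π/2 - θ)}`). [folklore] -/
theorem rectTheta_swap (ha : 0 < a) (hb : 0 < b) :
    rectTheta b a hb ha = π / 2 - rectTheta a b ha hb := by
  have hmem : ∀ z, z ∈ symRect b a ↔ -I * z ∈ symRect a b := by
    intro z
    simp only [mem_symRect, neg_mul, neg_re, neg_im, I_re, I_im, mul_re, mul_im, zero_mul, one_mul,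
      zero_sub, zero_add, neg_neg]
    constructor
    · rintro ⟨⟨h1, h2⟩, h3, h4⟩; exact ⟨⟨h3, h4⟩, by linarith, by linarith⟩
    · rintro ⟨⟨h1, h2⟩, h3, h4⟩; exact ⟨⟨by linarith, by linarith⟩, h1, h2⟩
  have h := rectPhi_transport ha hb hb ha (c := -I) (η := I) (by simp) (by simp) (r := 1) one_pos
    (by rw [mul_neg, I_mul_I, neg_neg, ofReal_one]) hmem (corner_mem_closure hb ha)
  have hcorner : -I * (⟨b, a⟩ : ℂ) = ⟨a, -b⟩ := by apply Complex.ext <;> simp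
  have hθ := rectTheta_mem ha hb
  have hI : exp (((π / 2 - rectTheta a b ha hb : ℝ) : ℂ) * I) = I * exp (-(rectTheta a b ha hb : ℂ) * I) := by
    rw [show ((π / 2 - rectTheta a b ha hb : ℝ) : ℂ) * I = π / 2 * I + (-(rectTheta a b ha hb : ℂ) * I) by
      push_cast; ring, Complex.exp_add, exp_pi_div_two_mul_I]
  rw [rectTheta, h, hcorner, rectPhi_corner_br ha hb, ← hI, arg_exp_mul_I,
    toIocMod_eq_self Real.two_pi_pos |>.2 ⟨by linarith [hθ.1, hθ.2], by linarith [hθ.1, hθ.2]⟩]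

end Transport

end Literature.Probability.RandomPlanarGeometry
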